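import Literature.NumberTheory.Automorphic.ShellTwistGL2Local
import Literature.NumberTheory.Automorphic.AdelicSecondCountable
import HarnessLib

/-!
# The shell projectors along the torus are pairwise orthogonal: Bessel's inequality over the shells

Topic `NumberTheory/Automorphic`; namespace `Literature.NumberTheory.Automorphic`. Groundwork for the
finite-place half of the Kirillov `L²`-bound of the smoothed Whittaker coefficient on `GL_2` (the
`n ≤ 2` case of the named fact `JacquetShalika1981_partialPairL_pole_of_eq_conj`), Hilbert-space
layer (theorems only).

At a finite place `v` let `J = J_{r,c} ≤ GL_2(K_v)` be a shell subgroup, `χ_v(j) = ψ_v(j₁₂)` its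
character (a twist datum for `π = R ∘ ι_v`, `isTwistData_shell`), `E` the twisted average
(`twistedAverage`, the orthogonal projection onto the `χ_v`-isotypic vectors of `J`) and
`a_m = diag(ϖ^m, 1)`. The conjugated projectors `E_m = π(a_m)⁻¹ E π(a_m)` satisfy
`π(n(ϖ^{-m} z)) E_m x = ψ_v(z) E_m x` for `|z| ≤ e^{r}` (`rep_upper_conjProjector`), so their ranges lie
in pairwise orthogonal `N(K_v)`-eigenspaces as soon as `ψ_v` is non-trivial on `𝔭^{-r}`
(`inner_conjProjector_eq_zero`: test against `n(z₁)`, `z₁ = ϖ^{-m} x₀ (1 - ϖ^k)⁻¹`). Bessel's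
inequality (`sum_norm_sq_le_of_pairwise_inner_eq_zero`) then gives, for every finite set of shells,

  `∑_m ‖E (π(a_m) x)‖² ≤ ‖x‖²`   (`sum_norm_sq_twistedAverage_torus_le`),

the finite-place substitute for the square-integrability of Kirillov functions (Jacquet–Shalika
(1981), §5, via the uniqueness of Whittaker models in print; here soft and global). All proofs
complete; no named facts.

## References

* H. Jacquet, J. A. Shalika, *On Euler products and the classification of automorphic
  representations I*, Amer. J. Math. 103 (1981), §5 [JacquetShalikaAJM1981].
* D. Bump, *Automorphic Forms and Representations*, CUP (1997), §4.4 [Bump1997].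
-/

noncomputable section

open scoped MatrixGroups ComplexConjugate InnerProductSpace
open Matrix WithZero NumberField IsDedekindDomain MeasureTheory Topology

namespace Literature.NumberTheory.Automorphic

open ShellGL2

section Local

variable {F : Type*} [Field F] [Valued F (WithZero (Multiplicative ℤ))]

local notation "𝐧" => (Matrix.GeneralLinearGroup.upperRightHom : AddChar F (GL (Fin 2) F))
local notation "𝐚" t:max => glDiagonal 2 F ![t, 1]

omit [Valued F (WithZero (Multiplicative ℤ))] in
/-- A `2 × 2` invertible matrix is determined by its four entries. [folklore] -/
theorem GL2_ext {g h : GL (Fin 2) F} (h00 : ent g 0 0 = ent h 0 0) (h01 : ent g 0 1 = ent h 0 1) (h10 : ent g 1 0 = ent h 1 0)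
    (h11 : ent g 1 1 = ent h 1 1) : g = h := by
  refine Matrix.GeneralLinearGroup.ext fun i j => ?_
  fin_cases i <;> fin_cases j
  · exact h00
  · exact h01
  · exact h10
  · exact h11

omit [Valued F (WithZero (Multiplicative ℤ))] in
/-- **Conjugating a unipotent by the torus**: `a(t)⁻¹ n(z) a(t) = n(t⁻¹ z)`. [folklore] -/
theorem aInv_mul_n_mul_a (t : Fˣ) (z : F) : (𝐚 t)⁻¹ * 𝐧 z * 𝐚 t = 𝐧 (((t⁻¹ : Fˣ) : F) * z) := by
  obtain ⟨e00, e01, e10, e11⟩ := ent_aInv_mul_mul_a t (𝐧 z)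
  obtain ⟨n00, n01, n10, n11⟩ := ent_n z
  obtain ⟨m00, m01, m10, m11⟩ := ent_n (((t⁻¹ : Fˣ) : F) * z)
  refine GL2_ext ?_ ?_ ?_ ?_
  · rw [e00, n00, m00]
  · rw [e01, n01, m01]
  · rw [e10, n10, m10, zero_mul]
  · rw [e11, n11, m11]

end Local

section Place

/-- `GL_2(K_v)` is second countable (as a subspace of `M_2(K_v) × M_2(K_v)ᵐᵒᵖ`). [folklore] -/
theorem secondCountableTopology_gl_local (K : Type) [Field K] [NumberField K] (v : HeightOneSpectrum (𝓞 K)) :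
    SecondCountableTopology (GL (Fin 2) (v.adicCompletion K)) := by
  haveI := secondCountableTopology_adicCompletion K v
  haveI : SecondCountableTopology (Matrix (Fin 2) (Fin 2) (v.adicCompletion K)) :=
    inferInstanceAs (SecondCountableTopology (Fin 2 → Fin 2 → v.adicCompletion K))
  haveI : SecondCountableTopology (Matrix (Fin 2) (Fin 2) (v.adicCompletion K))ᵐᵒᵖ :=
    MulOpposite.opHomeomorph.symm.secondCountableTopology
  exact Units.isEmbedding_embedProduct.secondCountableTopology

variable {K : Type} [Field K] [NumberField K] {v : HeightOneSpectrum (𝓞 K)}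
variable [MeasurableSpace (GL (Fin 2) (v.adicCompletion K))] [BorelSpace (GL (Fin 2) (v.adicCompletion K))]
variable {μ : Measure (AdelicGroupData.gl 2 K).automorphicQuotient} [(AdelicGroupData.gl 2 K).IsAutomorphicMeasure μ]

local notation "𝓋" => (Valued.v : Valuation (v.adicCompletion K) (WithZero (Multiplicative ℤ)))
local notation "𝐧ᵥ" => (Matrix.GeneralLinearGroup.upperRightHom : AddChar (v.adicCompletion K) (GL (Fin 2) (v.adicCompletion K)))
local notation "𝐚ᵥ" t:max => glDiagonal 2 (v.adicCompletion K) ![t, 1]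
local notation "πᵥ" => localRightRegular K v μ

variable {r c : ℤ} (hc : 1 ≤ c)
  (hψ : ∀ x : v.adicCompletion K, Valued.v x ≤ exp (r - c) → (adeleAddChar K).adicComponent v x = 1)

/-- The conjugated projector `E_a x = π(a)⁻¹ E (π(a) x)`. -/
local notation "Eₐ" a:max x:max => πᵥ a⁻¹ (twistedAverage (shellSubgroup (F := v.adicCompletion K) r c hc)
  (isCompact_shellSubgroup K v hc) πᵥ (shellChar K v) (πᵥ a x))

include hψ in
/-- **The conjugated projector is an `N(K_v)`-eigenvector**: for `|z| ≤ e^{r}`,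
`π(n(t⁻¹ z)) (π(a(t))⁻¹ E π(a(t)) x) = ψ_v(z) · (π(a(t))⁻¹ E π(a(t)) x)`. [cite: Bump1997, §4.4] -/
theorem rep_upper_conjProjector (t : (v.adicCompletion K)ˣ) {z : v.adicCompletion K} (hz : Valued.v z ≤ exp r)
    (x : (AdelicGroupData.gl 2 K).L2 μ) :
    πᵥ (𝐧ᵥ (((t⁻¹ : (v.adicCompletion K)ˣ) : v.adicCompletion K) * z)) (Eₐ (𝐚ᵥ t) x) =
      ((((adeleAddChar K).adicComponent v) z : Circle) : ℂ) • Eₐ (𝐚ᵥ t) x := by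
  have hT := isTwistData_shell K v μ hc hψ
  have h := hT.rep_conj_smul_of_twistedAverage (hJ := isCompact_shellSubgroup K v hc) (𝐚ᵥ t) (n_mem_shellSubgroup (hc := hc) hz) x
  rw [aInv_mul_n_mul_a] at h
  rw [h, shellChar_apply]
  rfl

omit [MeasurableSpace (GL (Fin 2) (v.adicCompletion K))] [BorelSpace (GL (Fin 2) (v.adicCompletion K))] in
/-- Uniformizer powers: `|ϖ^k| = e^{-k}`. [folklore] -/
theorem valued_zpow_uniformizer {ϖ : (v.adicCompletion K)ˣ} (hϖ : Valued.v (ϖ : v.adicCompletion K) = exp (-1 : ℤ)) (k : ℤ) :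
    Valued.v (((ϖ ^ k : (v.adicCompletion K)ˣ) : v.adicCompletion K)) = exp (-k) := by
  rw [Units.val_zpow_eq_zpow_val, map_zpow₀, hϖ, ← WithZero.exp_zsmul, smul_eq_mul, mul_neg, mul_one]

include hψ in
/-- **Orthogonality of the conjugated projectors along the torus**: for `m ≠ m'` and `ψ_v` non-trivial
on `𝔭^{-r}`, `⟪E_{a(ϖ^m)} x, E_{a(ϖ^{m'})} x⟫ = 0`. [cite: JacquetShalikaAJM1981, §5] -/
theorem inner_conjProjector_eq_zero {ϖ : (v.adicCompletion K)ˣ} (hϖ : Valued.v (ϖ : v.adicCompletion K) = exp (-1 : ℤ))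
    {x₀ : v.adicCompletion K} (hx₀ : Valued.v x₀ ≤ exp r) (hx₀ψ : (adeleAddChar K).adicComponent v x₀ ≠ 1)
    (x : (AdelicGroupData.gl 2 K).L2 μ) {m m' : ℤ} (hmm' : m ≠ m') :
    ⟪Eₐ (𝐚ᵥ (ϖ ^ m)) x, Eₐ (𝐚ᵥ (ϖ ^ m')) x⟫_ℂ = 0 := by
  have hT := isTwistData_shell K v μ hc hψ
  -- reduce to `m < m'`
  wlog hlt : m < m' generalizing m m'
  · have h' := this hmm'.symm (lt_of_le_of_ne (not_lt.1 hlt) hmm'.symm)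
    rw [← inner_conj_symm, h', map_zero]
  -- the test element `n(z₁)`, `z₁ = ϖ^{-m} z*`, `z* = x₀ (1 - ϖ^k)⁻¹`, `k = m' - m ≥ 1`
  set k : ℤ := m' - m with hk
  have hk1 : 1 ≤ k := by omega
  have hϖk : Valued.v (((ϖ ^ k : (v.adicCompletion K)ˣ) : v.adicCompletion K)) < 1 := by
    rw [valued_zpow_uniformizer hϖ, ← exp_zero, exp_lt_exp]; omega
  have hu : Valued.v (1 - ((ϖ ^ k : (v.adicCompletion K)ˣ) : v.adicCompletion K)) = 1 := Valuation.map_one_sub_of_lt _ hϖk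
  have hu0 : (1 - ((ϖ ^ k : (v.adicCompletion K)ˣ) : v.adicCompletion K)) ≠ 0 := fun h0 => by
    rw [h0, Valuation.map_zero] at hu; exact zero_ne_one hu
  set zs : v.adicCompletion K := x₀ * (1 - ((ϖ ^ k : (v.adicCompletion K)ˣ) : v.adicCompletion K))⁻¹ with hzs
  have hzs_v : Valued.v zs ≤ exp r := by
    rw [hzs, map_mul, map_inv₀, hu, inv_one, mul_one]; exact hx₀
  have hzs' : Valued.v (((ϖ ^ k : (v.adicCompletion K)ˣ) : v.adicCompletion K) * zs) ≤ exp r := by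
    rw [map_mul]
    calc _ ≤ 1 * exp r := mul_le_mul' hϖk.le hzs_v
      _ = exp r := one_mul _
  -- the common unipotent `n(z₁)` with `z₁ = (ϖ^m)⁻¹ zs = (ϖ^{m'})⁻¹ (ϖ^k zs)`
  have hz₁ : (((ϖ ^ m)⁻¹ : (v.adicCompletion K)ˣ) : v.adicCompletion K) * zs =
      (((ϖ ^ m')⁻¹ : (v.adicCompletion K)ˣ) : v.adicCompletion K) * ((((ϖ ^ k : (v.adicCompletion K)ˣ) : v.adicCompletion K)) * zs) := by
    have hu' : ((ϖ ^ m)⁻¹ : (v.adicCompletion K)ˣ) = (ϖ ^ m')⁻¹ * ϖ ^ k := by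
      rw [hk, ← _root_.zpow_neg, ← _root_.zpow_neg, ← _root_.zpow_add]; congr 1; ring
    rw [hu', Units.val_mul, mul_assoc]
  have h1 := rep_upper_conjProjector hc hψ (ϖ ^ m) hzs_v x
  have h2 := rep_upper_conjProjector hc hψ (ϖ ^ m') hzs' x
  rw [← hz₁] at h2
  -- the two eigenvalues differ by `ψ_v(x₀) ≠ 1`
  refine inner_eq_zero_of_rep_smul_ne (U := fun y => πᵥ (𝐧ᵥ ((((ϖ ^ m)⁻¹ : (v.adicCompletion K)ˣ) : v.adicCompletion K) * zs)) y)
    (hT.inner_rep_rep _) h1 h2 (Circle.norm_coe _) ?_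
  intro heq
  apply hx₀ψ
  have hsub : zs - ((ϖ ^ k : (v.adicCompletion K)ˣ) : v.adicCompletion K) * zs = x₀ := by
    rw [hzs, show ∀ a b : v.adicCompletion K, a - b * a = a * (1 - b) from fun a b => by ring, mul_assoc, inv_mul_cancel₀ hu0, mul_one]
  have hc' : ((adeleAddChar K).adicComponent v) zs = ((adeleAddChar K).adicComponent v) (((ϖ ^ k : (v.adicCompletion K)ˣ) : v.adicCompletion K) * zs) :=
    Subtype.ext heq
  have := AddChar.map_sub_eq_div ((adeleAddChar K).adicComponent v) zs (((ϖ ^ k : (v.adicCompletion K)ˣ) : v.adicCompletion K) * zs)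
  rw [hsub, hc', div_self'] at this
  exact this

include hψ in
/-- **Bessel's inequality over the shells**: for every finite set `s` of integers,
`∑_{m ∈ s} ‖E (π(a(ϖ^m)) x)‖² ≤ ‖x‖²` (the conjugated projectors are self-adjoint idempotents with
pairwise orthogonal values). [cite: JacquetShalikaAJM1981, §5] -/
theorem sum_norm_sq_twistedAverage_torus_le {ϖ : (v.adicCompletion K)ˣ} (hϖ : Valued.v (ϖ : v.adicCompletion K) = exp (-1 : ℤ))
    {x₀ : v.adicCompletion K} (hx₀ : Valued.v x₀ ≤ exp r) (hx₀ψ : (adeleAddChar K).adicComponent v x₀ ≠ 1)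
    (x : (AdelicGroupData.gl 2 K).L2 μ) (s : Finset ℤ) :
    ∑ m ∈ s, ‖twistedAverage (shellSubgroup (F := v.adicCompletion K) r c hc) (isCompact_shellSubgroup K v hc) πᵥ (shellChar K v)
        (πᵥ (𝐚ᵥ (ϖ ^ m)) x)‖ ^ 2 ≤ ‖x‖ ^ 2 := by
  haveI := secondCountableTopology_gl_local K v
  have hT := isTwistData_shell K v μ hc hψ
  have hnorm : ∀ m : ℤ, ‖twistedAverage (shellSubgroup (F := v.adicCompletion K) r c hc) (isCompact_shellSubgroup K v hc) πᵥ (shellChar K v)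
      (πᵥ (𝐚ᵥ (ϖ ^ m)) x)‖ = ‖Eₐ (𝐚ᵥ (ϖ ^ m)) x‖ := fun m => (hT.norm_rep_inv_apply _ _).symm
  simp_rw [hnorm]
  refine sum_norm_sq_le_of_pairwise_inner_eq_zero s (fun m y => Eₐ (𝐚ᵥ (ϖ ^ m)) y) x (fun m _ => ?_) (fun m _ m' _ hne => ?_)
  · show ‖Eₐ (𝐚ᵥ (ϖ ^ m)) x‖ ^ 2 = RCLike.re ⟪Eₐ (𝐚ᵥ (ϖ ^ m)) x, x⟫_ℂ
    rw [hT.norm_rep_inv_apply, hT.norm_sq_twistedAverage, hT.inner_rep_left, inv_inv]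
  · exact inner_conjProjector_eq_zero hc hψ hϖ hx₀ hx₀ψ x hne

end Place

end Literature.NumberTheory.Automorphic
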